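import Mathlib.Tactic.Sat.FromLRAT
import HarnessLib

/-!
# Boolean equality test for `Sat.Fmla` with a soundness lemma (plumbing for the LRAT replay files)

LADDER-QEC census cell `(16,1)`, kernel route (census/type-02/css161/KERNEL-PLAN.md item 4). Mathlib's `lrat_proof` command leaves a
private core theorem `lp.proof_k : Sat.Fmla.proof lp.ctx_j Sat.Clause.nil` whose formula `lp.ctx_j` is the clause list PARSED from the
DIMACS text; the instance files re-export it over the encoder's own formula `NFEnc.fmla c` (`Encode.lean`). The two closed terms are
equal, but letting the elaborator unfold a 20 000–40 000-clause formula exceeds the default heartbeat budget, and `Sat.Literal` carries no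
`DecidableEq` instance. This file provides a structural Boolean comparison `fmlaBEq` with `eq_of_fmlaBEq : fmlaBEq f g = true → f = g`, so
that the equality is established by ONE `decide +kernel` (kernel evaluation) and transported with `▸`. Definitions + their soundness
lemmas only; no instances. [folklore]
-/

set_option autoImplicit false

namespace Summit.Ventures.QEC.Census.CSSNormalFormSAT

/-- Boolean equality of literals. (definition) -/
def litBEq : Sat.Literal → Sat.Literal → Bool
  | .pos i, .pos j => i == j
  | .neg i, .neg j => i == j
  | _, _ => false

/-- Boolean equality of clauses (literal lists). (definition) -/
def clauseBEq : Sat.Clause → Sat.Clause → Bool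
  | [], [] => true
  | a :: as, b :: bs => litBEq a b && clauseBEq as bs
  | _, _ => false

/-- Boolean equality of formulas (clause lists). (definition) -/
def fmlaBEq : Sat.Fmla → Sat.Fmla → Bool
  | [], [] => true
  | c :: cs, d :: ds => clauseBEq c d && fmlaBEq cs ds
  | _, _ => false

/-- `litBEq` is sound. [folklore] -/
theorem eq_of_litBEq : ∀ a b : Sat.Literal, litBEq a b = true → a = b
  | .pos i, .pos j, h => by simp only [litBEq, beq_iff_eq] at h; rw [h]
  | .neg i, .neg j, h => by simp only [litBEq, beq_iff_eq] at h; rw [h]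
  | .pos _, .neg _, h => by simp [litBEq] at h
  | .neg _, .pos _, h => by simp [litBEq] at h

/-- `clauseBEq` is sound. [folklore] -/
theorem eq_of_clauseBEq : ∀ c d : Sat.Clause, clauseBEq c d = true → c = d
  | [], [], _ => rfl
  | a :: as, b :: bs, h => by
    simp only [clauseBEq, Bool.and_eq_true] at h
    rw [eq_of_litBEq a b h.1, eq_of_clauseBEq as bs h.2]
  | [], _ :: _, h => by simp [clauseBEq] at h
  | _ :: _, [], h => by simp [clauseBEq] at h

/-- `fmlaBEq` is sound: `fmlaBEq f g = true → f = g`. [folklore] -/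
theorem eq_of_fmlaBEq : ∀ f g : Sat.Fmla, fmlaBEq f g = true → f = g
  | [], [], _ => rfl
  | c :: cs, d :: ds, h => by
    simp only [fmlaBEq, Bool.and_eq_true] at h
    rw [eq_of_clauseBEq c d h.1, eq_of_fmlaBEq cs ds h.2]
  | [], _ :: _, h => by simp [fmlaBEq] at h
  | _ :: _, [], h => by simp [fmlaBEq] at h

/-- Transport of unsatisfiability along a checked formula equality. [folklore] -/
theorem proof_nil_of_fmlaBEq {f g : Sat.Fmla} (h : fmlaBEq f g = true) (hf : Sat.Fmla.proof f Sat.Clause.nil) :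
    Sat.Fmla.proof g Sat.Clause.nil :=
  eq_of_fmlaBEq f g h ▸ hf

end Summit.Ventures.QEC.Census.CSSNormalFormSAT
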